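import Literature.Analysis.FluidPDE.GalerkinFlow
import Literature.Analysis.FluidPDE.NSGalerkinTrajectory
import Literature.Analysis.FunctionSpaces.TorusSpaceTimeFields
import HarnessLib

/-!
# Field-level Galerkin trajectories solve the Galerkin ODE (the converse dictionary)

Analysis/FluidPDE proof file (theorems only; no definitions, no named facts). The tree carries TWO
notions of a Galerkin trajectory of the Navier–Stokes equations on `T^d` with a steady force `f`:
the COEFFICIENT level `IsGalerkinTrajectory ν S f u₀ α` (`NSEnstrophyBalance2DGalerkin`: `α`
solves the Fourier–Galerkin ODE `α' = V(f̂|_S, α)` of `NSGalerkinFourier`, where all the calculus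
lives — energy/enstrophy/critical identities, uniqueness and the semiflow `GalerkinFlow`) and the
FIELD level `Torus.IsGalerkinTrajectory ν f N U` (`NSGalerkinTrajectory`: jointly continuous,
Galerkin-mode slices, the Galerkin equations TESTED against every Galerkin mode and integrated in
time, energy identity — the clauses of `IsHopfGalerkinScheme` and of the cell skeletons that quantify
over «every Galerkin solution u_N», e.g. `Literature.Claims.NS.Karadzhov2026.IsGalerkin`). The tree
had the dictionary coefficient ⇒ field (`IsGalerkinTrajectory.torus_fourierTruncate`); this file
proves the converse (Robinson–Rodrigo–Sadowski 2016, §4.1: Def. 4.2 / (4.2) ⇔ the ODE (4.5),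
"existence and uniqueness ... is immediate from the classical theory of ODEs"):

* `Torus.IsGalerkinTrajectory.hasDerivWithinAt_fourierRestrict` — along a field-level trajectory
  with `f ∈ L²`, the coefficient curve `c(t) = 𝓕(U t)|_{|k| ≤ N}` satisfies
  `HasDerivWithinAt c (galerkinRHS (freqBall N) ν f̂|_{≤N} (c t)) (Icc 0 T) t` for `t ∈ [0, T]`.
  Proof: for every phase-space vector `x`, testing against the Galerkin mode `realTrigPoly x̄` and
  master identity I (`Torus.sum_re_inner_galerkinField_test`, with `∫⟪P_N f, a⟫ = ∫⟪f, a⟫`) give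
  `Re⟨c(t) − c(0) − ∫₀ᵗ V(c), x⟩ = 0`; the defect lies in the phase space (a finite-dimensional,
  hence closed, subspace containing the integrand: `Convex.set_average_mem`), so it vanishes; the
  fundamental theorem of calculus concludes.
* `Torus.IsGalerkinTrajectory.isGalerkinTrajectory_fourierRestrict` — packaged: the clamped
  coefficient curve `t ↦ 𝓕(U (max t 0))|_{≤N}` IS a coefficient-level Galerkin trajectory from
  `𝓕(U 0)|_{≤N}` whose velocity is `U` on `[0, ∞)`.

Consequently every coefficient-level estimate (e.g. the cutoff-uniform critical bound
`IsGalerkinTrajectory.critSobolev_add_integral_le` of `TorusGalerkinCriticalSobolevSmallData`)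
transfers to field-level trajectories. NOT here: time-dependent forces; uniqueness at the field
level (it follows from `IsGalerkinODESolution.eqOn` once the present bridge is applied, not stated).

## Mathlib / tree search

Reused: `IsGalerkinMode.fourierRestrict_mem`, `IsGalerkinMode.realTrigPoly_fourierRestrict`,
`isGalerkinMode_realTrigPoly_coeffExt`, `realTrigPoly_coeffExt_fourierRestrict` (`GalerkinFlow`),
`Torus.sum_re_inner_galerkinField_test`, `continuous_galerkinField`, `galerkinRHS_mem`
(`NSGalerkinFourier`), `continuousOn_mFourierCoeff_of_continuousOn_stLift` (`TorusSpaceTimeFields`),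
`integral_inner_fourierTruncate_eq`, `integral_inner_realTrigPoly_realTrigPoly`; Mathlib
`Convex.set_average_mem`, `Submodule.closed_of_finiteDimensional`,
`ContinuousLinearMap.intervalIntegral_comp_comm`, `Continuous.integral_hasStrictDerivAt`.
Searched `fourierRestrict.*hasDeriv`, `IsGalerkinTrajectory.*coeff`, `field.*coefficient`: only the
coefficient ⇒ field direction existed (`NSGalerkinTrajectory`).

## References

* J. C. Robinson, J. L. Rodrigo, W. Sadowski, *The Three-Dimensional Navier–Stokes Equations*,
  CUP 2016, §4.1 Def. 4.2, (4.2), Lemma 4.1, Thm. 4.4 Step 1 (4.5). [RobinsonRodrigoSadowskiCUP2016]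
* P. Constantin, C. Foias, *Navier–Stokes Equations*, Chicago 1988, Ch. 8 (8.3)–(8.6) (context).
-/

noncomputable section

open MeasureTheory Set Filter UnitAddTorus intervalIntegral
open scoped ENNReal NNReal InnerProductSpace Topology

namespace Literature.Analysis.FluidPDE

open FunctionSpaces.Torus Torus

variable {d : Type*} [Fintype d] [DecidableEq d] {ν : ℝ} {N : ℕ}
  {f : UnitAddTorus d → EuclideanSpace ℝ d} {U : ℝ → UnitAddTorus d → EuclideanSpace ℝ d}

/-- Slices of a field-level Galerkin trajectory have coefficient vectors in the phase space. [folklore] -/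
private theorem Torus.IsGalerkinTrajectory.fourierRestrict_mem (h : Torus.IsGalerkinTrajectory ν f N U)
    {t : ℝ} (ht : 0 ≤ t) : fourierRestrict (freqBall N) (U t) ∈ galerkinSubspace (freqBall N) :=
  (h.isGalerkinMode t ht).fourierRestrict_mem

/-- Slices of a field-level Galerkin trajectory are the real trigonometric polynomials of their
coefficients (`P_N (U t) = U t`). [folklore] -/
private theorem Torus.IsGalerkinTrajectory.realTrigPoly_eq (h : Torus.IsGalerkinTrajectory ν f N U)
    {t : ℝ} (ht : 0 ≤ t) :
    realTrigPoly (freqBall N) (coeffExt (freqBall N) (fourierRestrict (freqBall N) (U t))) = U t :=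
  (h.isGalerkinMode t ht).realTrigPoly_fourierRestrict

/-- The coefficient vector of a field-level Galerkin trajectory depends continuously on time on
`[0, ∞)`. [folklore] -/
private theorem Torus.IsGalerkinTrajectory.continuousOn_fourierRestrict
    (h : Torus.IsGalerkinTrajectory ν f N U) :
    ContinuousOn (fun t => fourierRestrict (freqBall N) (U t)) (Ici 0) :=
  continuousOn_pi.2 fun k =>
    FunctionSpaces.Torus.continuousOn_mFourierCoeff_of_continuousOn_stLift h.continuousOn k

omit [DecidableEq d] in
/-- The `L²` pairing of two Galerkin states is the real pairing of their coefficient vectors: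
`∫⟪realTrigPoly S c̄, realTrigPoly S x̄⟫ = ∑_k Re⟪c k, x k⟫`. [folklore] -/
private theorem integral_inner_realTrigPoly_coeffExt {S : Finset (d → ℤ)} (hS : ∀ k ∈ S, -k ∈ S)
    {c x : ↥S → EuclideanSpace ℂ d} (hc : IsRealCoeff c) (hx : IsRealCoeff x) :
    ∫ y, ⟪realTrigPoly S (coeffExt S c) y, realTrigPoly S (coeffExt S x) y⟫_ℝ =
      ∑ k : ↥S, (inner ℂ (c k) (x k)).re := by
  rw [integral_inner_realTrigPoly_realTrigPoly hS (hc.isConjSymm_coeffExt hS) (hx.isConjSymm_coeffExt hS),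
    sum_coeffExt (fun k v => (inner ℂ v (coeffExt S x k)).re)]
  exact Finset.sum_congr rfl fun k _ => by rw [coeffExt_coe]

/-- **Field-level Galerkin trajectories solve the Galerkin ODE.** Let `U` be a field-level Galerkin
trajectory of order `N` on `T^d` with viscosity `ν` and steady force `f ∈ L²`
(`Torus.IsGalerkinTrajectory ν f N U`: jointly continuous, Galerkin-mode slices, the Galerkin
equations tested against every Galerkin mode and integrated in time, the energy identity;
Robinson–Rodrigo–Sadowski 2016, Def. 4.2 / (4.2), (4.5)). Then its coefficient vector
`c(t) = 𝓕(U t)|_{|k| ≤ N}` solves the Fourier–Galerkin ODE `ċ = V(f̂|_{≤N}, c)` (`galerkinRHS`) within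
`[0, T]` at every `t ∈ [0, T]` — the converse of the tree's dictionary
`IsGalerkinTrajectory.torus_fourierTruncate` (coefficient level ⇒ field level). Proof: for every
phase-space vector `x`, testing against the Galerkin mode `realTrigPoly x̄` and master identity I
(`Torus.sum_re_inner_galerkinField_test`) give `⟨c(t) − c(0) − ∫₀ᵗ V(c), x⟩ = 0`; the left factor
lies in the phase space, so it vanishes; the fundamental theorem of calculus concludes.
[cite: RobinsonRodrigoSadowskiCUP2016, §4.1 Def. 4.2, (4.2), Thm. 4.4 Step 1 (4.5)] -/
theorem Torus.IsGalerkinTrajectory.hasDerivWithinAt_fourierRestrict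
    (h : Torus.IsGalerkinTrajectory ν f N U) (hf : MemLp f 2 volume) (T : ℝ) {t : ℝ}
    (ht : t ∈ Icc 0 T) :
    HasDerivWithinAt (fun τ => fourierRestrict (freqBall N) (U τ))
      (galerkinRHS (freqBall N) ν (fourierRestrict (freqBall N) f)
        (fourierRestrict (freqBall N) (U t))) (Icc 0 T) t := by
  -- notation
  set S : Finset (d → ℤ) := freqBall N with hS_def
  have hS : ∀ k ∈ S, -k ∈ S := neg_mem_freqBall_of_mem
  set G : Submodule ℝ (↥S → EuclideanSpace ℂ d) := galerkinSubspace S with hG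
  set g : ↥S → EuclideanSpace ℂ d := fourierRestrict S f with hg_def
  have hgr : IsRealCoeff g := isRealCoeff_mFourierCoeff (hf.integrable one_le_two)
  set c : ℝ → ↥S → EuclideanSpace ℂ d := fun τ => fourierRestrict S (U τ) with hc_def
  set V : (↥S → EuclideanSpace ℂ d) → (↥S → EuclideanSpace ℂ d) := fun x => galerkinRHS S ν g x
    with hV_def
  have hc_mem : ∀ τ, 0 ≤ τ → c τ ∈ G := fun τ hτ => h.fourierRestrict_mem hτ
  have hV_mem : ∀ x ∈ G, V x ∈ G := fun x hx => galerkinRHS_mem ν hS hgr hx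
  have hc_cont : ContinuousOn c (Ici 0) := h.continuousOn_fourierRestrict
  have hV_cont : Continuous V := by
    refine continuous_pi fun k => ?_
    simp only [hV_def, galerkinRHS_apply]
    refine continuous_galerkinField ν (fun _ => continuous_const) (fun l => ?_) (k : d → ℤ)
    by_cases hl : l ∈ S
    · simp only [coeffExt_of_mem _ hl]; exact continuous_apply _
    · simp only [coeffExt_of_not_mem _ hl]; exact continuous_const
  -- the clamped curve `τ ↦ c (max τ 0)` is continuous on `ℝ` and agrees with `c` on `[0, ∞)`
  set cc : ℝ → ↥S → EuclideanSpace ℂ d := fun τ => c (max τ 0) with hcc_def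
  have hcc_cont : Continuous cc :=
    hc_cont.comp_continuous (continuous_id.max continuous_const) fun τ => Set.mem_Ici.2 (le_max_right _ _)
  have hcc_eq : ∀ {τ}, 0 ≤ τ → cc τ = c τ := fun hτ => by simp only [hcc_def, max_eq_left hτ]
  have hF_cont : Continuous fun τ => V (cc τ) := hV_cont.comp hcc_cont
  -- the primitive `I t = ∫₀ᵗ V(c)` and its derivative
  set I : ℝ → ↥S → EuclideanSpace ℂ d := fun s => ∫ τ in (0 : ℝ)..s, V (cc τ) with hI_def
  have hI_deriv : ∀ s, HasDerivAt I (V (cc s)) s := fun s =>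
    (hF_cont.integral_hasStrictDerivAt 0 s).hasDerivAt
  -- KEY: `c t' = c 0 + I t'` for `t' ≥ 0`
  have hkey : ∀ t', 0 ≤ t' → c t' = c 0 + I t' := by
    intro t' ht'
    -- the real pairing with a phase-space vector `x`, as a continuous linear functional
    have hpair : ∀ x ∈ G, ∑ k : ↥S, (inner ℂ ((c t' - c 0 - I t') k) (x k)).re = 0 := by
      intro x hx
      let Lₗ : (↥S → EuclideanSpace ℂ d) →ₗ[ℝ] ℝ :=
        { toFun := fun y => ∑ k : ↥S, (inner ℂ (y k) (x k)).re
          map_add' := fun y z => by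
            simp only [Pi.add_apply, inner_add_left, Complex.add_re, Finset.sum_add_distrib]
          map_smul' := fun r y => by
            simp only [Pi.smul_apply, RingHom.id_apply, smul_eq_mul, Finset.mul_sum]
            refine Finset.sum_congr rfl fun k _ => ?_
            rw [RCLike.real_smul_eq_coe_smul (K := ℂ), inner_smul_left]
            show ((starRingEnd ℂ) (r : ℂ) * inner ℂ (y k) (x k)).re = r * (inner ℂ (y k) (x k)).re
            rw [Complex.conj_ofReal, Complex.re_ofReal_mul] }
      set L : (↥S → EuclideanSpace ℂ d) →L[ℝ] ℝ := LinearMap.toContinuousLinearMap Lₗ with hL_def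
      have hL : ∀ y : ↥S → EuclideanSpace ℂ d, L y = ∑ k : ↥S, (inner ℂ (y k) (x k)).re :=
        fun y => rfl
      -- the Galerkin mode `a = realTrigPoly S x̄`
      set a : UnitAddTorus d → EuclideanSpace ℝ d := realTrigPoly S (coeffExt S x) with ha_def
      have ha : IsGalerkinMode N a := isGalerkinMode_realTrigPoly_coeffExt hx
      have hband : ∀ k ∉ S, mFourierCoeff (FunctionSpaces.EuclideanSpace.complexify ∘ a) k = 0 :=
        fun k hk => ha.mFourierCoeff_eq_zero (not_mem_freqBall.1 hk)
      have hxa : ∀ k ∈ S, mFourierCoeff (FunctionSpaces.EuclideanSpace.complexify ∘ a) k =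
          coeffExt S x k := fun k hk => by
        rw [ha_def, mFourierCoeff_realTrigPoly hS (hx.1.isConjSymm_coeffExt hS), if_pos hk]
      -- the tested Galerkin equation against `a` on `[0, t']`
      have hgal := h.galerkin a ha 0 t' le_rfl ht'
      -- left side: pairings of the coefficient vectors
      have hLc : ∀ τ, 0 ≤ τ → ∫ y, ⟪U τ y, a y⟫_ℝ = L (c τ) := by
        intro τ hτ
        rw [hL, ← h.realTrigPoly_eq hτ, ha_def]
        exact integral_inner_realTrigPoly_coeffExt hS (hc_mem τ hτ).1 hx.1
      -- right side: master identity I at each time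
      have hRV : ∀ τ, 0 ≤ τ → ∫ y, (⟪U τ y, FunctionSpaces.Torus.convect (U τ) a y⟫_ℝ +
          ν * ⟪U τ y, FunctionSpaces.Torus.laplacian a y⟫_ℝ + ⟪f y, a y⟫_ℝ) = L (V (c τ)) := by
        intro τ hτ
        have hcτ := hc_mem τ hτ
        have hI1 := sum_re_inner_galerkinField_test ν hS (hgr.isConjSymm_coeffExt hS)
          (hcτ.1.isConjSymm_coeffExt hS) hcτ.2.isTransversal_coeffExt ha.isSmooth ha.isDivFree hband
        rw [h.realTrigPoly_eq hτ, realTrigPoly_coeffExt_fourierRestrict N f] at hI1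
        -- replace `P_N f` by `f` against the band-limited `a`
        have hforce : ∫ y, ⟪fourierTruncate N f y, a y⟫_ℝ = ∫ y, ⟪f y, a y⟫_ℝ :=
          integral_inner_fourierTruncate_eq hf (ha.isSmooth.memLp 2) hband
        have hu : IsSmooth (U τ) := (h.isGalerkinMode τ hτ).isSmooth
        have iAB : Integrable (fun y => ⟪U τ y, FunctionSpaces.Torus.convect (U τ) a y⟫_ℝ +
            ν * ⟪U τ y, FunctionSpaces.Torus.laplacian a y⟫_ℝ) volume :=
          (hu.inner (hu.convect ha.isSmooth)).integrable.add
            (((hu.inner ha.isSmooth.laplacian).integrable).const_mul ν)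
        have iP : Integrable (fun y => ⟪fourierTruncate N f y, a y⟫_ℝ) volume :=
          ((isSmooth_fourierTruncate N f).inner ha.isSmooth).integrable
        have iF : Integrable (fun y => ⟪f y, a y⟫_ℝ) volume :=
          integrable_inner_of_continuous (hf.integrable one_le_two) ha.isSmooth.continuous
        rw [integral_add iAB iP, hforce, ← integral_add iAB iF] at hI1
        rw [← hI1, hL, ← Finset.sum_coe_sort S]
        refine Finset.sum_congr rfl fun k _ => ?_
        rw [hV_def]
        dsimp only
        rw [galerkinRHS_apply, hxa k k.2, coeffExt_coe]
      -- assemble: `L (c t') - L (c 0) = ∫₀^{t'} L (V (c τ)) dτ = L (I t')`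
      have hint : L (I t') = ∫ τ in (0 : ℝ)..t', L (V (cc τ)) := by
        simp only [hI_def]
        exact (L.intervalIntegral_comp_comm (hF_cont.intervalIntegrable 0 t')).symm
      have hR : ∫ τ in (0 : ℝ)..t', ∫ y, (⟪U τ y, FunctionSpaces.Torus.convect (U τ) a y⟫_ℝ +
          ν * ⟪U τ y, FunctionSpaces.Torus.laplacian a y⟫_ℝ + ⟪f y, a y⟫_ℝ) =
          ∫ τ in (0 : ℝ)..t', L (V (cc τ)) := by
        refine intervalIntegral.integral_congr fun τ hτ => ?_
        have hτ0 : 0 ≤ τ := by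
          rw [uIcc_of_le ht'] at hτ; exact hτ.1
        rw [hRV τ hτ0, hcc_eq hτ0]
      rw [hLc t' ht', hLc 0 le_rfl, hR, ← hint] at hgal
      rw [← hL, map_sub, map_sub]
      linarith
    -- the defect lies in the phase space (a closed subspace containing the integrand), hence vanishes
    have hImem : I t' ∈ G := by
      rcases ht'.eq_or_lt with h0 | hpos
      · rw [← h0, hI_def]
        simp only [intervalIntegral.integral_same]
        exact G.zero_mem
      · have hGclosed : IsClosed (G : Set (↥S → EuclideanSpace ℂ d)) := G.closed_of_finiteDimensional
        have hfs : ∀ᵐ τ ∂((volume : Measure ℝ).restrict (Ioc 0 t')), V (cc τ) ∈ (G : Set _) :=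
          Eventually.of_forall fun τ => hV_mem _ (hc_mem _ (le_max_right _ _))
        have hfi : IntegrableOn (fun τ => V (cc τ)) (Ioc 0 t') volume :=
          (hF_cont.integrableOn_Icc).mono_set Ioc_subset_Icc_self
        have hvol : (volume : Measure ℝ) (Ioc 0 t') = ENNReal.ofReal t' := by
          rw [Real.volume_Ioc, sub_zero]
        have hne : (volume : Measure ℝ) (Ioc 0 t') ≠ 0 := by
          rw [hvol]; exact (ENNReal.ofReal_pos.2 hpos).ne'
        have htop : (volume : Measure ℝ) (Ioc 0 t') ≠ ⊤ := by rw [hvol]; exact ENNReal.ofReal_ne_top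
        have havg := G.convex.set_average_mem hGclosed hne htop hfs hfi
        have hr : (volume : Measure ℝ).real (Ioc 0 t') = t' := by
          rw [measureReal_def, hvol, ENNReal.toReal_ofReal hpos.le]
        have hIeq : I t' = t' • ⨍ τ in Ioc 0 t', V (cc τ) := by
          simp only [hI_def]
          rw [intervalIntegral.integral_of_le hpos.le, setAverage_eq, hr, smul_smul,
            mul_inv_cancel₀ hpos.ne', one_smul]
        rw [hIeq]
        exact G.smul_mem _ havg
    have hW : c t' - c 0 - I t' ∈ G := G.sub_mem (G.sub_mem (hc_mem t' ht') (hc_mem 0 le_rfl)) hImem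
    have h0 := hpair _ hW
    have hsq : ∑ k : ↥S, ‖(c t' - c 0 - I t') k‖ ^ 2 = 0 := by
      calc ∑ k : ↥S, ‖(c t' - c 0 - I t') k‖ ^ 2
          = ∑ k : ↥S, (inner ℂ ((c t' - c 0 - I t') k) ((c t' - c 0 - I t') k)).re :=
            Finset.sum_congr rfl fun k _ => (inner_self_eq_norm_sq (𝕜 := ℂ) _).symm
        _ = 0 := h0
    have hzero : c t' - c 0 - I t' = 0 := by
      funext k
      have hk := (Finset.sum_eq_zero_iff_of_nonneg fun k _ => sq_nonneg _).1 hsq k (Finset.mem_univ _)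
      exact norm_eq_zero.1 (pow_eq_zero_iff two_ne_zero |>.1 hk)
    rw [sub_sub, sub_eq_zero] at hzero
    exact hzero
  -- conclusion: `c = c 0 + I` on `[0, T]`, and `I' = V(c)`
  have hD : HasDerivWithinAt (fun τ => c 0 + I τ) (V (cc t)) (Icc 0 T) t :=
    ((hI_deriv t).hasDerivWithinAt).const_add (c 0)
  have hD' : HasDerivWithinAt c (V (cc t)) (Icc 0 T) t :=
    hD.congr (fun τ hτ => hkey τ hτ.1) (hkey t ht.1)
  rw [hcc_eq ht.1] at hD'
  exact hD'

/-- **Field-level Galerkin trajectories are coefficient-level Galerkin trajectories** (packaged form of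
`Torus.IsGalerkinTrajectory.hasDerivWithinAt_fourierRestrict`): for a field-level Galerkin trajectory
`U` of order `N` with steady force `f ∈ L²`, the coefficient curve `t ↦ 𝓕(U (max t 0))|_{|k| ≤ N}`
(clamped to `t ≥ 0`, where the field-level notion lives) is a Galerkin trajectory of order
`freqBall N` in the tree's coefficient-level sense (`IsGalerkinTrajectory ν (freqBall N) f (U 0) α`:
Galerkin ODE on every `[0, T]`, phase-space valued, continuous, issued from `𝓕(U 0)|_{≤N}`), and its
velocity is `U` on `[0, ∞)`. With `IsGalerkinTrajectory.torus_fourierTruncate` this makes the two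
notions interchangeable (Robinson–Rodrigo–Sadowski 2016, Def. 4.2 ⇔ (4.5)).
[cite: RobinsonRodrigoSadowskiCUP2016, §4.1 Def. 4.2, Thm. 4.4 Step 1 (4.5)] -/
theorem Torus.IsGalerkinTrajectory.isGalerkinTrajectory_fourierRestrict
    (h : Torus.IsGalerkinTrajectory ν f N U) (hf : MemLp f 2 volume) :
    _root_.Literature.Analysis.FluidPDE.IsGalerkinTrajectory ν (freqBall N) f (U 0)
        (fun t => fourierRestrict (freqBall N) (U (max t 0))) ∧
      ∀ t : ℝ, 0 ≤ t →
        galerkinVelocity (freqBall N) (fun t => fourierRestrict (freqBall N) (U (max t 0))) t = U t := by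
  have hS : ∀ k ∈ freqBall (d := d) N, -k ∈ freqBall (d := d) N := neg_mem_freqBall_of_mem
  have hcont : ContinuousOn (fun t => fourierRestrict (freqBall N) (U (max t 0))) (Ici 0) :=
    (h.continuousOn_fourierRestrict.comp_continuous (continuous_id.max continuous_const)
      fun τ => Set.mem_Ici.2 (le_max_right _ _)).continuousOn
  refine ⟨⟨hS, by simp, fun t => h.fourierRestrict_mem (le_max_right _ _), hcont, fun T t ht => ?_⟩,
    fun t ht => ?_⟩
  · have hd := h.hasDerivWithinAt_fourierRestrict hf T ht
    rw [show max t 0 = t from max_eq_left ht.1]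
    exact hd.congr (fun τ hτ => by simp only [max_eq_left hτ.1]) (by simp only [max_eq_left ht.1])
  · rw [galerkinVelocity_apply]
    simp only [max_eq_left ht]
    exact h.realTrigPoly_eq ht

/-! ### Uniqueness of field-level Galerkin trajectories and identification with the semiflow
(appended 2026-08-27, salvage-p4 g5) -/

/-- **Uniqueness of field-level Galerkin trajectories** (Robinson–Rodrigo–Sadowski 2016, Thm 4.4
Step 1: "existence and uniqueness ... is immediate from the classical theory of ODEs"): two
field-level Galerkin trajectories of order `N` with the same steady force `f ∈ L²` and the same
initial slice coincide on `[0, ∞)` — their coefficient curves solve the same Galerkin ODE from the same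
datum (`Torus.IsGalerkinTrajectory.isGalerkinTrajectory_fourierRestrict`), so they agree by
`IsGalerkinODESolution.eqOn`, and each trajectory is the velocity of its coefficient curve.
[cite: RobinsonRodrigoSadowskiCUP2016, §4.1 Thm. 4.4 Step 1 (4.5)] -/
theorem Torus.IsGalerkinTrajectory.eq_of_initial_eq {V : ℝ → UnitAddTorus d → EuclideanSpace ℝ d}
    (hU : Torus.IsGalerkinTrajectory ν f N U) (hV : Torus.IsGalerkinTrajectory ν f N V)
    (hf : MemLp f 2 volume) (h0 : U 0 = V 0) {t : ℝ} (ht : 0 ≤ t) : U t = V t := by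
  obtain ⟨hαU, hvelU⟩ := hU.isGalerkinTrajectory_fourierRestrict hf
  obtain ⟨hαV, hvelV⟩ := hV.isGalerkinTrajectory_fourierRestrict hf
  have hα := hαU.isGalerkinODESolution
  have hβ := hαV.isGalerkinODESolution
  rw [h0] at hα
  have heq := hα.eqOn hβ ht
  rw [← hvelU t ht, ← hvelV t ht, galerkinVelocity_apply, galerkinVelocity_apply]
  exact congrArg (fun c => realTrigPoly (freqBall N) (coeffExt (freqBall N) c)) heq

/-- **Every field-level Galerkin trajectory is the orbit of the Galerkin semiflow** (`GalerkinFlow`):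
for `ν ≥ 0` and a steady force `f ∈ L²`, along a field-level trajectory `U` of order `N`,
`U t = Torus.galerkinFlow ν f N t (U 0)` for all `t ≥ 0` (the orbit of the Galerkin mode `U 0` is a
field-level trajectory from `U 0` — `IsGalerkinMode.isGalerkinTrajectory_galerkinFlow` with
`IsGalerkinTrajectory.torus_fourierTruncate`/`galerkin_identity` packaged in
`IsGalerkinMode.galerkinFlow_clauses` — and uniqueness). [cite: RobinsonRodrigoSadowskiCUP2016, §4.1 Thm. 4.4 Steps 1–2] -/
theorem Torus.IsGalerkinTrajectory.eq_galerkinFlow (hU : Torus.IsGalerkinTrajectory ν f N U)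
    (hν : 0 ≤ ν) (hf : MemLp f 2 volume) {t : ℝ} (ht : 0 ≤ t) :
    U t = Torus.galerkinFlow ν f N t (U 0) := by
  have ha : IsGalerkinMode N (U 0) := hU.isGalerkinMode 0 le_rfl
  -- the coefficient curve of `U` is THE Galerkin ODE solution from `𝓕(U 0)|_{≤N}`
  obtain ⟨hαU, hvelU⟩ := hU.isGalerkinTrajectory_fourierRestrict hf
  have hsol := isGalerkinODESolution_galerkinCoeffFlow hν
    (neg_mem_freqBall_of_mem (N := N)) (isRealCoeff_mFourierCoeff (hf.integrable one_le_two))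
    ha.fourierRestrict_mem
  have heq := hαU.isGalerkinODESolution.eqOn hsol ht
  rw [ha.galerkinFlow_eq, ← hvelU t ht, galerkinVelocity_apply]
  exact congrArg (fun c => realTrigPoly (freqBall N) (coeffExt (freqBall N) c)) heq

end Literature.Analysis.FluidPDE
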